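import Summits.QuantumFields.YangMills.Theorems.BalabanUVNodesN21TopLetteredReading13CoPHDefs
import Summits.QuantumFields.YangMills.Theorems.BalabanUVNodesN21SelectedTopCut13CoPHRecord

/-!
# N21 (NE7c) · THE TOP-LETTERED SPINE READING — FACES: `KeyedExtraction` (E1 ∕ E2 for EVERY `g₀`) and `KeyedShellWeight` ((M1)-FREE `T4IndicatorShell.ShellWeightBound`,
# canonical `Wsh` included) AT `crTop₁₃VAt K₀ jcut ρ n` are THEOREMS on the live-selector line (rows: `hsel`, (H-ζ), `ρ_K ≤ 1`, `Σ_K 1∕(n_K+1) < ∞`); the N20 face and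
# N19′'s core ∕ U4′'s summability are TRANSFERS from witnesses at the top-lettered carriers (no estimate)

R134 seat `pub-ymgap-dag-n21-d` (g10), node N21 = NE7c, strategy s2; lane K3⁷ `SpineGivenEndpointR13SepCoPH` (stmt-QuantumFields-20544, `--supports … --as helper`;
COUNT-NEUTRAL).  Imports R1 `…N21TopLetteredReading13CoPHDefs` (the reading) and T3 `…N21SelectedTopCut13CoPHRecord` (through it T1∕T2: the RT identity, the E1-step, the
RT-pigeonhole `sum_range_sum_topBand_le`, `argmin_badness_bounds`; g9 FILE 3's `integrable_chi_mul_dressedSlots_of_ppSelLive`; this seat's `zetaOfRecord_nonneg`; K0c's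
absolute `localBgMeasurable`; dag-n19-d's E1 at every level `sum_classWeightOfDatum₉_datumOfRecord₁₃CoPH_eq_schemeZ_of_ppSelLive`; n20-d's canonical-weight transfers
`relWeightBound_wInf ∕ shellWeightBound_wshInf ∕ core_deltaCan ∕ summable_deltaCan ∕ wInf_add_wshInf_lt_one`) — all BY NAME.

WHAT THIS FILE PROVES (theorems only; 0 `def`, 0 `sorry`).
* §24 LEVEL LEMMAS (NODE 00's generality; `cases` on the level): `topClassWeightAt_nonneg`, `topTermAtLevel_nonneg`, `topBandAtLevel_nonneg`, `topBandAtLevel_le`,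
  ★ `sum_topTermAtLevel_eq_schemeZ_of_liveSel` (E1 AT EVERY TOP LETTER: `Σ_s topTerm^{θ}_j(s) = schemeZ … p.K t` at the run's top `j = p.K`),
  ★★ `sum_range_sum_topBandAtLevel_le_of_liveSel` (`Σ_{i<m} Σ_s topBand_j(θ_i, θ_{i+1}) ≤ (2L^m)⁴ · schemeZ … p.K t`, `ρ ≤ 1`).
* §25 AT THE READING: ★★ `topBandSum_selTopDepth_le` (both runs at the argmin: `≤ (2(2L^m)⁴∕(n+1))·schemeZ`), fibre sums (`sum_classSet₁₃_topWeightA₁₃ ∕ _B ∕ _topShellA₁₃ ∕ _B`,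
  `sum_classSet₁₃_topWeightA₁₃_eq_schemeZ ∕ _B`), (R) (`topShellA₁₃_nonneg ∕ _le ∕ …`), ★★★ `shellWeightBound_carriersTop₁₃` — `ShellWeightBound 1 (classSet₁₃ θ K₀ g₀)
  (topWeightA₁₃ …) (topWeightB₁₃ …) (topShellA₁₃ …) (topShellB₁₃ …) (K ↦ 2(2L^m)⁴·(1∕(n_K+1)))` with NO anti-concentration, ★★★ `shellWeightBound_crTop₁₃VAt` (the K3
  skeleton's `KeyedShellWeight` shape AT THE READING, canonical `Wsh`), ★★ `keyedExtraction_crTop₁₃VAt` (the `KeyedExtraction` shape: `0 < l₀`, `0 < vol`, E1 ∕ E2 for EVERY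
  `g₀`), and the transfers ★ `relWeightBound_crTop₁₃VAt` · ★ `core_crTop₁₃VAt` · `lt_one_crTop₁₃VAt` (any witness at the carriers ⇒ the face at the reading);
  `selTopCutA∕B_mem_window` — the selected letters lie in `[ε(1 − ρ_K)^{n_K}, ε]` below the runs' own `ε` (the consumer's admissible-factor obligation, [LF-I] p.181).

HONEST FRAMING (binding).  Bookkeeping BY NAME + [folklore]; NO estimate of Bałaban's.  The N21 face here is for the two runs' (2.18) expansions RE-LETTERED AT THE TOP STEP at
a letter selected per `(K,t)` below print's `ε` ([LF-I] p.181) — NOT for print's fixed threshold (`crOfRecord₁₃VAt`, where (M1) stands); the N20 face (persistence weight) and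
N19′'s core at this reading are NOT claimed (transfers; N19′ must cut its core at the selected letter — T3 §20a `topClassWeight_sub_topBand_eq_lowered` is the object); the top
𝐑-step is omitted in the top-lettered terms (integral-preserving; `{0,1}` ratios at the identity selector); whether the K3 skeleton's `PinnedAtLive` should admit this reading
is the PLANNER's call.  A4∕A6 (ref-J READ-213's vacuity note, made explicit): the rows `ρ_K ≤ 1`, `Σ 1∕(n_K+1) < ∞` do NOT exclude the JUNK INSTANCE `ρ_K → 1` or
`n_K ρ_K` large, where the selected letter `ε(1 − ρ_K)^{i⋆}` may collapse toward `0` (every cube «large», shells trivially empty): the reading is CONTENT only when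
`(1 − ρ_K)^{n_K}` stays bounded below (the consumer's admissible-factor obligation — `selTopCutA∕B_mem_window` below displays the window; e.g. `n_K ρ_K ≤ β`, `ρ_K`
N16's geometric closeness), which this file does NOT assert.  No `Provisos₁₃CoPH` inhabitant claimed (K0⁷ open); NE7c NOT PRINTED ∕ NOT proved at print's thresholds; N21 NOT discharged; K3⁷ NOT claimed; counts
UNMOVED (typed 28∕28 · discharged 5∕27); never a count claim.  No `instance`, no `notation`, no `def`.  One finite four-torus programme at fixed `ε` — NOT ℝ⁴, NOT OS, NOT a
mass gap, NOT the Clay problem.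
-/

noncomputable section

open scoped BigOperators
open Finset MeasureTheory

namespace Summit.QuantumFields.YangMills.Theorems.N21ShellSplitOfRecord13CoPH

open Literature.MathematicalPhysics.QuantumFieldTheory.Balaban1983to89
open Literature.MathematicalPhysics.QuantumFieldTheory.Balaban1983to89.T4Continuum
open Literature.MathematicalPhysics.QuantumFieldTheory.Balaban1983to89.Node00
open T4WeightBudget (RelWeightBound)
open T4IndicatorShell (ShellWeightBound)
open T4ContinuumYM4Torus (ForSmallCouplings)
open YMDAG.UVSplit (SpineReading₁₃CoPH keyA₁₃ keyB₁₃ runA₁₃ runB₁₃ histA₁₃ histB₁₃ histA₁₃_zero histB₁₃_zero classSet₁₃ badClass₁₃)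
open Summit.QuantumFields.BalabanUV.T4Continuum.Spine
open Summit.QuantumFields.YangMills.BalabanUVNodes.SpineCanonicalWeights
open Summit.QuantumFields.YangMills.BalabanUVNodes.N19MGFFormAtRecord (wOfRecord₉_nonneg)
open Summit.QuantumFields.YangMills.Theorems.N21StepWeightsPositivity (zetaOfRecord_nonneg)
open Summit.QuantumFields.YangMills.BalabanUVNodes.N19MGFFormAtRecordMass (sum_classWeightOfDatum₉_datumOfRecord₁₃CoPH_eq_schemeZ_of_ppSelLive)

/-! ## §24 Level lemmas (NODE 00's generality at a Stage-13 tuple on the live line) -/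

section LevelFacts

variable (F : T4Family) (N : ℕ) [NeZero N] (ϑ : Stage9Params F N) (D : FiniteEpsData F (SU N)) (g₀ : ℕ → ℝ) (os : List (ULoop F))
  (p : B12.RunParams) (g : ℕ → ℝ)

/-- `0 ≤` the top-lettered class weight (`χ ≥ 0`, `topSlot ≥ 0`). [bookkeeping] -/
theorem topClassWeightAt_nonneg (k : ℕ) (hζ0 : ∀ p g k s Pl Ql RS U V', 0 ≤ ϑ.ζ p g k s Pl Ql RS U V') (θ t : ℝ) (s' : SeqOfRecord F ϑ.ν ϑ.τ9.M g p.K (k + 1)) :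
    0 ≤ topClassWeightAt F N ϑ D g₀ os p g k θ t s' :=
  integral_nonneg fun V => mul_nonneg (chiSeqOfRecordAt_nonneg F N ϑ.ν ϑ.τ9.M g p.K (k + 1) θ s' V) (topSlotAt_nonneg F N ϑ D g₀ os p g k hζ0 θ t s' V)

/-- `0 ≤` the top-lettered term at every level. [bookkeeping] -/
theorem topTermAtLevel_nonneg (hζ0 : ∀ p g k s Pl Ql RS U V', 0 ≤ ϑ.ζ p g k s Pl Ql RS U V') (θ t : ℝ) :
    ∀ (j : ℕ) (s : SeqOfRecord F ϑ.ν ϑ.τ9.M g p.K j), 0 ≤ topTermAtLevel F N ϑ D g₀ os p g θ t j s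
  | 0, s => classWeightOfDatum₉_nonneg' F N ϑ D g₀ os p g 0 (wOfRecord₉_nonneg ϑ hζ0 p g) t s
  | k + 1, s' => topClassWeightAt_nonneg F N ϑ D g₀ os p g k hζ0 θ t s'

/-- `0 ≤` the top-lettered band at every level. [bookkeeping] -/
theorem topBandAtLevel_nonneg (hζ0 : ∀ p g k s Pl Ql RS U V', 0 ≤ ϑ.ζ p g k s Pl Ql RS U V') (θ θ' t : ℝ) :
    ∀ (j : ℕ) (s : SeqOfRecord F ϑ.ν ϑ.τ9.M g p.K j), 0 ≤ topBandAtLevel F N ϑ D g₀ os p g θ θ' t j s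
  | 0, _ => le_rfl
  | k + 1, s' => topBandWeightAt_nonneg F N ϑ D g₀ os p g k hζ0 θ θ' t s'

/-- the top-lettered band never exceeds the top-lettered term, at the run's top `j = p.K` (F3's (e1) integrability below the top displayed). [bookkeeping] -/
theorem topBandAtLevel_le (hζ0 : ∀ p g k s Pl Ql RS U V', 0 ≤ ϑ.ζ p g k s Pl Ql RS U V') (hζm : ZetaMeasurable F N ϑ.ζ) (hζ1 : IsZetaAbsLeOne F N ϑ.ν ϑ.τ9.M ϑ.ζ)
    (θ θ' t : ℝ)
    (hint : ∀ k, k < p.K → ∀ s : SeqOfRecord F ϑ.ν ϑ.τ9.M g p.K k,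
      Integrable (fun U => chiSeqOfRecord F N ϑ.ν ϑ.τ9.M g p.K k s U * dressedSlotsOfDatum₉ F N ϑ D g₀ os t p g k s U) (fieldMeasure (F.P p.K) k (SU N))) :
    ∀ (j : ℕ), j = p.K → ∀ s : SeqOfRecord F ϑ.ν ϑ.τ9.M g p.K j, topBandAtLevel F N ϑ D g₀ os p g θ θ' t j s ≤ topTermAtLevel F N ϑ D g₀ os p g θ t j s
  | 0, _, s => classWeightOfDatum₉_nonneg' F N ϑ D g₀ os p g 0 (wOfRecord₉_nonneg ϑ hζ0 p g) t s
  | k + 1, hk, s' => topBandWeightAt_le_topClassWeight F N ϑ D g₀ os p g k (by omega) hζ0 hζm hζ1 θ θ' t (hint k (by omega)) s'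

end LevelFacts

section LevelLive

variable {F : T4Family} {N : ℕ} [NeZero N]

/-- ★ **E1 AT EVERY TOP LETTER, AT THE RUN's TOP** (`j = p.K`, a Stage-13 tuple on the live line, any run `p` with `g 0 = g₀ p.K`):
`Σ_s topTerm^{θ}_j(s) = schemeZ (datum.scheme g₀) os p.K t` — level `0`: dag-n19-d's E1 at level `0`; level `k+1`: T2's E1-step + dag-n19-d's E1 at level `k`. [bookkeeping] -/
theorem sum_topTermAtLevel_eq_schemeZ_of_liveSel (θ : Stage13HParams F N) (hP : θ.Provisos₁₃CoPH F N) (E : B12.RunParams → ℝ)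
    (hsel : θ.ppSel = ppSelLiveOfRecord F N θ.ν θ.τ9 E (wOfRecord₉ F N θ.toStage9Params)) (hζm : ZetaMeasurable F N θ.ζ) (g₀ : ℕ → ℝ) (os : List (ULoop F))
    {p : B12.RunParams} {g : ℕ → ℝ} (hg : g 0 = g₀ p.K) (θtop t : ℝ) :
    ∀ j : ℕ, j = p.K → ∑ s, topTermAtLevel F N θ.toStage9Params (datumOfRecord₁₃CoPH F N θ hP) g₀ os p g θtop t j s =
      T4GenFunBounds.schemeZ ((datumOfRecord₁₃CoPH F N θ hP).scheme g₀) os p.K t := by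
  have hζ0 : ∀ p g k s Pl Ql RS U V', 0 ≤ θ.ζ p g k s Pl Ql RS U V' :=
    fun p g k s Pl Ql RS U V' => zetaOfRecord_nonneg F N θ.ν θ.τ9.M hP.zetaUnity hP.zetaAbs p g k s Pl Ql RS U V'
  have hU : LocalBgMeasurable F N θ.ν := localBgMeasurable F N θ.ν
  have hD : (datumOfRecord₁₃CoPH F N θ hP).AvgMeasurable := (isPrintedAveraged_datumOfRecord₁₃CoPH F N θ hP).avgMeasurable
  intro j hj
  cases j with
  | zero =>
    simp only [topTermAtLevel_zero]
    exact sum_classWeightOfDatum₉_datumOfRecord₁₃CoPH_eq_schemeZ_of_ppSelLive θ hP E hsel hU hζm hζ0 g₀ os hg t 0 (Nat.zero_le _)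
  | succ k =>
    simp only [topTermAtLevel_succ]
    rw [sum_topClassWeightAt_eq F N θ.toStage9Params (datumOfRecord₁₃CoPH F N θ hP) g₀ os p g k hj hζm hP.zetaAbs hP.zetaUnity θtop t
      (fun s => integrable_chi_mul_dressedSlots_of_ppSelLive θ.toStage9Params E hsel hU hζm hζ0 hP.zetaAbs _ hD g₀ os hg t k s)]
    exact sum_classWeightOfDatum₉_datumOfRecord₁₃CoPH_eq_schemeZ_of_ppSelLive θ hP E hsel hU hζm hζ0 g₀ os hg t k (by omega)

/-- ★★ **THE PIGEONHOLE AT THE RUN's TOP, AGAINST THE PARTITION FUNCTION** (`j = p.K`, `ρ ≤ 1`): `Σ_{i<m} Σ_s topBand_j(θ_i, θ_{i+1}) ≤ (2L^m)⁴ · schemeZ … p.K t` — level `0`: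
no band; level `k+1`: T2's `sum_range_sum_topBand_le` + dag-n19-d's E1 at level `k`. [bookkeeping] -/
theorem sum_range_sum_topBandAtLevel_le_of_liveSel (θ : Stage13HParams F N) (hP : θ.Provisos₁₃CoPH F N) (E : B12.RunParams → ℝ)
    (hsel : θ.ppSel = ppSelLiveOfRecord F N θ.ν θ.τ9 E (wOfRecord₉ F N θ.toStage9Params)) (hζm : ZetaMeasurable F N θ.ζ) (g₀ : ℕ → ℝ) (os : List (ULoop F))
    {p : B12.RunParams} {g : ℕ → ℝ} (hg : g 0 = g₀ p.K) {ρ : ℝ} (hρ : ρ ≤ 1) (m : ℕ) (t : ℝ) :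
    ∀ j : ℕ, j = p.K → ∑ i ∈ Finset.range m, ∑ s, topBandAtLevel F N θ.toStage9Params (datumOfRecord₁₃CoPH F N θ hP) g₀ os p g
        (cutGrid θ.ν g j ρ i) (cutGrid θ.ν g j ρ (i + 1)) t j s ≤
      (2 * (F.L : ℝ) ^ F.m) ^ 4 * T4GenFunBounds.schemeZ ((datumOfRecord₁₃CoPH F N θ hP).scheme g₀) os p.K t := by
  have hζ0 : ∀ p g k s Pl Ql RS U V', 0 ≤ θ.ζ p g k s Pl Ql RS U V' :=
    fun p g k s Pl Ql RS U V' => zetaOfRecord_nonneg F N θ.ν θ.τ9.M hP.zetaUnity hP.zetaAbs p g k s Pl Ql RS U V'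
  have hU : LocalBgMeasurable F N θ.ν := localBgMeasurable F N θ.ν
  have hD : (datumOfRecord₁₃CoPH F N θ hP).AvgMeasurable := (isPrintedAveraged_datumOfRecord₁₃CoPH F N θ hP).avgMeasurable
  have hZ0 : 0 ≤ T4GenFunBounds.schemeZ ((datumOfRecord₁₃CoPH F N θ hP).scheme g₀) os p.K t := by
    rw [← sum_classWeightOfDatum₉_datumOfRecord₁₃CoPH_eq_schemeZ_of_ppSelLive θ hP E hsel hU hζm hζ0 g₀ os hg t 0 (Nat.zero_le _)]
    exact Finset.sum_nonneg fun s _ => classWeightOfDatum₉_nonneg' F N θ.toStage9Params (datumOfRecord₁₃CoPH F N θ hP) g₀ os p g 0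
      (wOfRecord₉_nonneg θ.toStage9Params hζ0 p g) t s
  intro j hj
  cases j with
  | zero =>
    simp only [topBandAtLevel_zero, Finset.sum_const_zero]
    exact mul_nonneg (by positivity) hZ0
  | succ k =>
    simp only [topBandAtLevel_succ]
    rw [← sum_classWeightOfDatum₉_datumOfRecord₁₃CoPH_eq_schemeZ_of_ppSelLive θ hP E hsel hU hζm hζ0 g₀ os hg t k (by omega)]
    exact sum_range_sum_topBand_le F N θ.toStage9Params (datumOfRecord₁₃CoPH F N θ hP) g₀ os p g k hj hζ0 hζm hP.zetaAbs hP.zetaUnity hρ m t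
      (fun s => integrable_chi_mul_dressedSlots_of_ppSelLive θ.toStage9Params E hsel hU hζm hζ0 hP.zetaAbs _ hD g₀ os hg t k s)

end LevelLive

/-! ## §25 At the top-lettered reading: the argmin bound, fibre sums, (R), `ShellWeightBound`, `KeyedExtraction`, transfers -/

section AtReading

variable {F : T4Family} {N : ℕ} [NeZero N]

/-- ★★ **BOTH RUNS' TOP-LETTERED BAND MASSES AT THE SELECTED DEPTH ARE `≤ (2(2L^m)⁴∕(n+1)) ×` THE RUNS' PARTITION FUNCTIONS** (§24's pigeonhole in each run + the argmin
`selTopDepth₁₃`); rows `hsel`, (H-ζ), `ρ_K ≤ 1`; NO anti-concentration. [bookkeeping] -/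
theorem topBandSum_selTopDepth_le (K₀ : ℕ) (θ : Stage13HParams F N) (hP : θ.Provisos₁₃CoPH F N) (g₀ : ℕ → ℝ) (os : List (ULoop F)) (E : B12.RunParams → ℝ)
    (hsel : θ.ppSel = ppSelLiveOfRecord F N θ.ν θ.τ9 E (wOfRecord₉ F N θ.toStage9Params)) (hζm : ZetaMeasurable F N θ.ζ)
    {ρ : ℕ → ℝ} (hρ1 : ∀ K, ρ K ≤ 1) (n K : ℕ) (t : ℝ) :
    topBandSumA₁₃ θ hP K₀ g₀ os ρ K (selTopDepth₁₃ θ hP K₀ g₀ os ρ n K t) t ≤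
        2 * (2 * (F.L : ℝ) ^ F.m) ^ 4 / (n + 1 : ℕ) * T4GenFunBounds.schemeZ ((datumOfRecord₁₃CoPH F N θ hP).scheme g₀) os (K₀ + K) t ∧
      topBandSumB₁₃ θ hP K₀ g₀ os ρ K (selTopDepth₁₃ θ hP K₀ g₀ os ρ n K t) t ≤
        2 * (2 * (F.L : ℝ) ^ F.m) ^ 4 / (n + 1 : ℕ) * T4GenFunBounds.schemeZ ((datumOfRecord₁₃CoPH F N θ hP).scheme g₀) os (K₀ + K + 1) t := by
  have hζ0 : ∀ p g k s Pl Ql RS U V', 0 ≤ θ.ζ p g k s Pl Ql RS U V' :=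
    fun p g k s Pl Ql RS U V' => zetaOfRecord_nonneg F N θ.ν θ.τ9.M hP.zetaUnity hP.zetaAbs p g k s Pl Ql RS U V'
  have hU : LocalBgMeasurable F N θ.ν := localBgMeasurable F N θ.ν
  -- the two partition functions are nonnegative (E1 at level 0)
  have hZ : ∀ (p : B12.RunParams) (g : ℕ → ℝ), g 0 = g₀ p.K → 0 ≤ T4GenFunBounds.schemeZ ((datumOfRecord₁₃CoPH F N θ hP).scheme g₀) os p.K t := by
    intro p g hg
    rw [← sum_classWeightOfDatum₉_datumOfRecord₁₃CoPH_eq_schemeZ_of_ppSelLive θ hP E hsel hU hζm hζ0 g₀ os hg t 0 (Nat.zero_le _)]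
    exact Finset.sum_nonneg fun s _ => classWeightOfDatum₉_nonneg' F N θ.toStage9Params (datumOfRecord₁₃CoPH F N θ hP) g₀ os p g 0
      (wOfRecord₉_nonneg θ.toStage9Params hζ0 p g) t s
  have hfA := sum_range_sum_topBandAtLevel_le_of_liveSel θ hP E hsel hζm g₀ os (p := runA₁₃ F K₀ g₀ K) (histA₁₃_zero θ K₀ g₀ K) (hρ1 K) (n + 1) t (K₀ + K) rfl
  have hfB := sum_range_sum_topBandAtLevel_le_of_liveSel θ hP E hsel hζm g₀ os (p := runB₁₃ F K₀ g₀ K) (histB₁₃_zero θ K₀ g₀ K) (hρ1 K) (n + 1) t (K₀ + K + 1) rfl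
  have hA0 : ∀ i, 0 ≤ topBandSumA₁₃ θ hP K₀ g₀ os ρ K i t := fun i => Finset.sum_nonneg fun s _ =>
    topBandAtLevel_nonneg F N θ.toStage9Params (datumOfRecord₁₃CoPH F N θ hP) g₀ os (runA₁₃ F K₀ g₀ K) (histA₁₃ θ K₀ g₀ K) hζ0 _ _ t _ s
  have hB0 : ∀ i, 0 ≤ topBandSumB₁₃ θ hP K₀ g₀ os ρ K i t := fun i => Finset.sum_nonneg fun s' _ =>
    topBandAtLevel_nonneg F N θ.toStage9Params (datumOfRecord₁₃CoPH F N θ hP) g₀ os (runB₁₃ F K₀ g₀ K) (histB₁₃ θ K₀ g₀ K) hζ0 _ _ t _ s'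
  have hspec := selTopDepth₁₃_spec θ hP K₀ g₀ os ρ n K t
  exact argmin_badness_bounds (f := fun i => topBandSumA₁₃ θ hP K₀ g₀ os ρ K i t) (g := fun i => topBandSumB₁₃ θ hP K₀ g₀ os ρ K i t) hA0 hB0
    (hZ (runA₁₃ F K₀ g₀ K) _ (histA₁₃_zero θ K₀ g₀ K)) (hZ (runB₁₃ F K₀ g₀ K) _ (histB₁₃_zero θ K₀ g₀ K)) (by positivity) hfA hfB hspec.1 hspec.2

/-- run A: the class-set sum of the top-lettered weights is the full sum of the top-lettered terms at the selected letter. [bookkeeping] -/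
theorem sum_classSet₁₃_topWeightA₁₃ (K₀ : ℕ) (θ : Stage13HParams F N) (hP : θ.Provisos₁₃CoPH F N) (g₀ : ℕ → ℝ) (os : List (ULoop F)) (ρ : ℕ → ℝ) (n : ℕ → ℕ)
    (K : ℕ) (t : ℝ) :
    ∑ x ∈ classSet₁₃ θ K₀ g₀ K, topWeightA₁₃ θ hP K₀ g₀ os ρ n K t x =
      ∑ s, topTermAtLevel F N θ.toStage9Params (datumOfRecord₁₃CoPH F N θ hP) g₀ os (runA₁₃ F K₀ g₀ K) (histA₁₃ θ K₀ g₀ K)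
        (cutGrid θ.ν (histA₁₃ θ K₀ g₀ K) (K₀ + K) (ρ K) (selTopDepth₁₃ θ hP K₀ g₀ os ρ (n K) K t)) t (K₀ + K) s := by
  letI : ∀ Kc, DecidableEq (SiteSeqKey F Kc) := fun _ => Classical.decEq _
  exact Finset.sum_fiberwise_of_maps_to (s := Finset.univ) (t := classSet₁₃ θ K₀ g₀ K) (g := keyA₁₃ θ K₀ g₀ K)
    (fun s _ => Finset.mem_union_left _ (Finset.mem_image_of_mem _ (Finset.mem_univ s))) _

/-- run B: the same along `keyB₁₃`. [bookkeeping] -/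
theorem sum_classSet₁₃_topWeightB₁₃ (K₀ : ℕ) (θ : Stage13HParams F N) (hP : θ.Provisos₁₃CoPH F N) (g₀ : ℕ → ℝ) (os : List (ULoop F)) (ρ : ℕ → ℝ) (n : ℕ → ℕ)
    (K : ℕ) (t : ℝ) :
    ∑ x ∈ classSet₁₃ θ K₀ g₀ K, topWeightB₁₃ θ hP K₀ g₀ os ρ n K t x =
      ∑ s', topTermAtLevel F N θ.toStage9Params (datumOfRecord₁₃CoPH F N θ hP) g₀ os (runB₁₃ F K₀ g₀ K) (histB₁₃ θ K₀ g₀ K)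
        (cutGrid θ.ν (histB₁₃ θ K₀ g₀ K) (K₀ + K + 1) (ρ K) (selTopDepth₁₃ θ hP K₀ g₀ os ρ (n K) K t)) t (K₀ + K + 1) s' := by
  letI : ∀ Kc, DecidableEq (SiteSeqKey F Kc) := fun _ => Classical.decEq _
  exact Finset.sum_fiberwise_of_maps_to (s := Finset.univ) (t := classSet₁₃ θ K₀ g₀ K) (g := keyB₁₃ θ K₀ g₀ K)
    (fun s' _ => Finset.mem_union_right _ (Finset.mem_image_of_mem _ (Finset.mem_univ s'))) _

/-- run A: the class-set sum of the top-lettered shell parts is the run's band mass at the selected depth. [bookkeeping] -/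
theorem sum_classSet₁₃_topShellA₁₃ (K₀ : ℕ) (θ : Stage13HParams F N) (hP : θ.Provisos₁₃CoPH F N) (g₀ : ℕ → ℝ) (os : List (ULoop F)) (ρ : ℕ → ℝ) (n : ℕ → ℕ)
    (K : ℕ) (t : ℝ) :
    ∑ x ∈ classSet₁₃ θ K₀ g₀ K, topShellA₁₃ θ hP K₀ g₀ os ρ n K t x = topBandSumA₁₃ θ hP K₀ g₀ os ρ K (selTopDepth₁₃ θ hP K₀ g₀ os ρ (n K) K t) t := by
  letI : ∀ Kc, DecidableEq (SiteSeqKey F Kc) := fun _ => Classical.decEq _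
  exact Finset.sum_fiberwise_of_maps_to (s := Finset.univ) (t := classSet₁₃ θ K₀ g₀ K) (g := keyA₁₃ θ K₀ g₀ K)
    (fun s _ => Finset.mem_union_left _ (Finset.mem_image_of_mem _ (Finset.mem_univ s))) _

/-- run B: the same. [bookkeeping] -/
theorem sum_classSet₁₃_topShellB₁₃ (K₀ : ℕ) (θ : Stage13HParams F N) (hP : θ.Provisos₁₃CoPH F N) (g₀ : ℕ → ℝ) (os : List (ULoop F)) (ρ : ℕ → ℝ) (n : ℕ → ℕ)
    (K : ℕ) (t : ℝ) :
    ∑ x ∈ classSet₁₃ θ K₀ g₀ K, topShellB₁₃ θ hP K₀ g₀ os ρ n K t x = topBandSumB₁₃ θ hP K₀ g₀ os ρ K (selTopDepth₁₃ θ hP K₀ g₀ os ρ (n K) K t) t := by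
  letI : ∀ Kc, DecidableEq (SiteSeqKey F Kc) := fun _ => Classical.decEq _
  exact Finset.sum_fiberwise_of_maps_to (s := Finset.univ) (t := classSet₁₃ θ K₀ g₀ K) (g := keyB₁₃ θ K₀ g₀ K)
    (fun s' _ => Finset.mem_union_right _ (Finset.mem_image_of_mem _ (Finset.mem_univ s'))) _

/-- ★ **E1 AT THE READING**: run A's top-lettered class weights sum over the class set to the run's dressed partition function (rows `hsel`, (H-ζ)). [bookkeeping] -/
theorem sum_classSet₁₃_topWeightA₁₃_eq_schemeZ (K₀ : ℕ) (θ : Stage13HParams F N) (hP : θ.Provisos₁₃CoPH F N) (g₀ : ℕ → ℝ) (os : List (ULoop F))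
    (E : B12.RunParams → ℝ) (hsel : θ.ppSel = ppSelLiveOfRecord F N θ.ν θ.τ9 E (wOfRecord₉ F N θ.toStage9Params)) (hζm : ZetaMeasurable F N θ.ζ)
    (ρ : ℕ → ℝ) (n : ℕ → ℕ) (K : ℕ) (t : ℝ) :
    ∑ x ∈ classSet₁₃ θ K₀ g₀ K, topWeightA₁₃ θ hP K₀ g₀ os ρ n K t x = T4GenFunBounds.schemeZ ((datumOfRecord₁₃CoPH F N θ hP).scheme g₀) os (K₀ + K) t := by
  rw [sum_classSet₁₃_topWeightA₁₃]
  exact sum_topTermAtLevel_eq_schemeZ_of_liveSel θ hP E hsel hζm g₀ os (p := runA₁₃ F K₀ g₀ K) (histA₁₃_zero θ K₀ g₀ K) _ t (K₀ + K) rfl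

/-- ★ **E2 AT THE READING**: run B's. [bookkeeping] -/
theorem sum_classSet₁₃_topWeightB₁₃_eq_schemeZ (K₀ : ℕ) (θ : Stage13HParams F N) (hP : θ.Provisos₁₃CoPH F N) (g₀ : ℕ → ℝ) (os : List (ULoop F))
    (E : B12.RunParams → ℝ) (hsel : θ.ppSel = ppSelLiveOfRecord F N θ.ν θ.τ9 E (wOfRecord₉ F N θ.toStage9Params)) (hζm : ZetaMeasurable F N θ.ζ)
    (ρ : ℕ → ℝ) (n : ℕ → ℕ) (K : ℕ) (t : ℝ) :
    ∑ x ∈ classSet₁₃ θ K₀ g₀ K, topWeightB₁₃ θ hP K₀ g₀ os ρ n K t x = T4GenFunBounds.schemeZ ((datumOfRecord₁₃CoPH F N θ hP).scheme g₀) os (K₀ + K + 1) t := by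
  rw [sum_classSet₁₃_topWeightB₁₃]
  exact sum_topTermAtLevel_eq_schemeZ_of_liveSel θ hP E hsel hζm g₀ os (p := runB₁₃ F K₀ g₀ K) (histB₁₃_zero θ K₀ g₀ K) _ t (K₀ + K + 1) rfl

/-- ★★★ **N21's OUTPUT SHAPE AT THE TOP-LETTERED CARRIERS, (M1)-FREE.**  At a `CoPH`-keyed Stage-13 tuple on the live-selector line (`hsel`), under (H-ζ), with the letter rows
`ρ_K ≤ 1` and `Summable (K ↦ 1∕(n_K+1))`: `ShellWeightBound 1 (classSet₁₃ θ K₀ g₀) (topWeightA₁₃ …) (topWeightB₁₃ …) (topShellA₁₃ …) (topShellB₁₃ …) (K ↦ 2(2L^m)⁴·(1∕(n_K+1)))`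
— every field PROVED; NO anti-concentration, NO estimate of Bałaban's. [bookkeeping] -/
theorem shellWeightBound_carriersTop₁₃ (K₀ : ℕ) (θ : Stage13HParams F N) (hP : θ.Provisos₁₃CoPH F N) (g₀ : ℕ → ℝ) (os : List (ULoop F)) (E : B12.RunParams → ℝ)
    (hsel : θ.ppSel = ppSelLiveOfRecord F N θ.ν θ.τ9 E (wOfRecord₉ F N θ.toStage9Params)) (hζm : ZetaMeasurable F N θ.ζ)
    {ρ : ℕ → ℝ} {n : ℕ → ℕ} (hρ1 : ∀ K, ρ K ≤ 1) (hn : Summable (fun K => 1 / ((n K : ℝ) + 1))) :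
    ShellWeightBound 1 (classSet₁₃ θ K₀ g₀) (topWeightA₁₃ θ hP K₀ g₀ os ρ n) (topWeightB₁₃ θ hP K₀ g₀ os ρ n) (topShellA₁₃ θ hP K₀ g₀ os ρ n)
      (topShellB₁₃ θ hP K₀ g₀ os ρ n) (fun K => 2 * (2 * (F.L : ℝ) ^ F.m) ^ 4 * (1 / ((n K : ℝ) + 1))) := by
  have hζ0 : ∀ p g k s Pl Ql RS U V', 0 ≤ θ.ζ p g k s Pl Ql RS U V' :=
    fun p g k s Pl Ql RS U V' => zetaOfRecord_nonneg F N θ.ν θ.τ9.M hP.zetaUnity hP.zetaAbs p g k s Pl Ql RS U V'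
  have hU : LocalBgMeasurable F N θ.ν := localBgMeasurable F N θ.ν
  have hD : (datumOfRecord₁₃CoPH F N θ hP).AvgMeasurable := (isPrintedAveraged_datumOfRecord₁₃CoPH F N θ hP).avgMeasurable
  have hνbar : 0 ≤ 2 * (2 * (F.L : ℝ) ^ F.m) ^ 4 := by positivity
  have hconst : ∀ K, 2 * (2 * (F.L : ℝ) ^ F.m) ^ 4 / (n K + 1 : ℕ) = 2 * (2 * (F.L : ℝ) ^ F.m) ^ 4 * (1 / ((n K : ℝ) + 1)) := fun K => by
    push_cast
    ring
  have hintA : ∀ K k, k < (runA₁₃ F K₀ g₀ K).K → ∀ s : SeqOfRecord F θ.ν θ.τ9.M (histA₁₃ θ K₀ g₀ K) (runA₁₃ F K₀ g₀ K).K k, ∀ t : ℝ,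
      Integrable (fun U => chiSeqOfRecord F N θ.ν θ.τ9.M (histA₁₃ θ K₀ g₀ K) (runA₁₃ F K₀ g₀ K).K k s U *
        dressedSlotsOfDatum₉ F N θ.toStage9Params (datumOfRecord₁₃CoPH F N θ hP) g₀ os t (runA₁₃ F K₀ g₀ K) (histA₁₃ θ K₀ g₀ K) k s U)
        (fieldMeasure (F.P (runA₁₃ F K₀ g₀ K).K) k (SU N)) :=
    fun K k _ s t => integrable_chi_mul_dressedSlots_of_ppSelLive θ.toStage9Params E hsel hU hζm hζ0 hP.zetaAbs _ hD g₀ os (histA₁₃_zero θ K₀ g₀ K) t k s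
  have hintB : ∀ K k, k < (runB₁₃ F K₀ g₀ K).K → ∀ s : SeqOfRecord F θ.ν θ.τ9.M (histB₁₃ θ K₀ g₀ K) (runB₁₃ F K₀ g₀ K).K k, ∀ t : ℝ,
      Integrable (fun U => chiSeqOfRecord F N θ.ν θ.τ9.M (histB₁₃ θ K₀ g₀ K) (runB₁₃ F K₀ g₀ K).K k s U *
        dressedSlotsOfDatum₉ F N θ.toStage9Params (datumOfRecord₁₃CoPH F N θ hP) g₀ os t (runB₁₃ F K₀ g₀ K) (histB₁₃ θ K₀ g₀ K) k s U)
        (fieldMeasure (F.P (runB₁₃ F K₀ g₀ K).K) k (SU N)) :=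
    fun K k _ s t => integrable_chi_mul_dressedSlots_of_ppSelLive θ.toStage9Params E hsel hU hζm hζ0 hP.zetaAbs _ hD g₀ os (histB₁₃_zero θ K₀ g₀ K) t k s
  letI : ∀ Kc, DecidableEq (SiteSeqKey F Kc) := fun _ => Classical.decEq _
  refine
    { nonneg := fun K => mul_nonneg hνbar (by positivity)
      summable := hn.mul_left _
      sh_nonneg_left := fun K t _ x _ => Finset.sum_nonneg fun s _ =>
        topBandAtLevel_nonneg F N θ.toStage9Params (datumOfRecord₁₃CoPH F N θ hP) g₀ os (runA₁₃ F K₀ g₀ K) (histA₁₃ θ K₀ g₀ K) hζ0 _ _ t _ s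
      sh_le_left := fun K t _ x _ => Finset.sum_le_sum fun s _ =>
        topBandAtLevel_le F N θ.toStage9Params (datumOfRecord₁₃CoPH F N θ hP) g₀ os (runA₁₃ F K₀ g₀ K) (histA₁₃ θ K₀ g₀ K) hζ0 hζm hP.zetaAbs _ _ t
          (fun k hk s => hintA K k hk s t) (K₀ + K) rfl s
      sh_nonneg_right := fun K t _ x _ => Finset.sum_nonneg fun s' _ =>
        topBandAtLevel_nonneg F N θ.toStage9Params (datumOfRecord₁₃CoPH F N θ hP) g₀ os (runB₁₃ F K₀ g₀ K) (histB₁₃ θ K₀ g₀ K) hζ0 _ _ t _ s'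
      sh_le_right := fun K t _ x _ => Finset.sum_le_sum fun s' _ =>
        topBandAtLevel_le F N θ.toStage9Params (datumOfRecord₁₃CoPH F N θ hP) g₀ os (runB₁₃ F K₀ g₀ K) (histB₁₃ θ K₀ g₀ K) hζ0 hζm hP.zetaAbs _ _ t
          (fun k hk s => hintB K k hk s t) (K₀ + K + 1) rfl s'
      left := fun K t _ => ?_
      right := fun K t _ => ?_ }
  · rw [sum_classSet₁₃_topShellA₁₃, sum_classSet₁₃_topWeightA₁₃_eq_schemeZ K₀ θ hP g₀ os E hsel hζm, ← hconst K]
    exact (topBandSum_selTopDepth_le K₀ θ hP g₀ os E hsel hζm hρ1 (n K) K t).1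
  · rw [sum_classSet₁₃_topShellB₁₃, sum_classSet₁₃_topWeightB₁₃_eq_schemeZ K₀ θ hP g₀ os E hsel hζm, ← hconst K]
    exact (topBandSum_selTopDepth_le K₀ θ hP g₀ os E hsel hζm hρ1 (n K) K t).2

/-- ★★★ **`KeyedShellWeight` AT THE TOP-LETTERED READING, (M1)-FREE**: on the live-selector line, under (H-ζ), with `ρ_K ≤ 1` and `Σ_K 1∕(n_K+1) < ∞` read at the tuple:
`ShellWeightBound` AT `crTop₁₃VAt N K₀ jcut ρ n` — its `l₀, T, A, B, shA, shB` and its CANONICAL `Wsh` (n20-d's `shellWeightBound_wshInf`).  `jcut` is not read. [bookkeeping] -/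
theorem shellWeightBound_crTop₁₃VAt (K₀ : ℕ) (jcut : ℕ → ℕ) (ρ : WidthLetter₁₃CoPH N) (n : DepthLetter₁₃CoPH N) (θ : Stage13HParams F N) (hP : θ.Provisos₁₃CoPH F N)
    (g₀ : ℕ → ℝ) (os : List (ULoop F)) (E : B12.RunParams → ℝ) (hsel : θ.ppSel = ppSelLiveOfRecord F N θ.ν θ.τ9 E (wOfRecord₉ F N θ.toStage9Params))
    (hζm : ZetaMeasurable F N θ.ζ) (hρ1 : ∀ K, ρ F θ hP g₀ os K ≤ 1) (hn : Summable (fun K => 1 / ((n F θ hP g₀ os K : ℝ) + 1))) :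
    ShellWeightBound (crTop₁₃VAt N K₀ jcut ρ n F θ hP g₀ os).l₀ (crTop₁₃VAt N K₀ jcut ρ n F θ hP g₀ os).T (crTop₁₃VAt N K₀ jcut ρ n F θ hP g₀ os).A
      (crTop₁₃VAt N K₀ jcut ρ n F θ hP g₀ os).B (crTop₁₃VAt N K₀ jcut ρ n F θ hP g₀ os).shA (crTop₁₃VAt N K₀ jcut ρ n F θ hP g₀ os).shB
      (crTop₁₃VAt N K₀ jcut ρ n F θ hP g₀ os).Wsh :=
  shellWeightBound_wshInf (shellWeightBound_carriersTop₁₃ K₀ θ hP g₀ os E hsel hζm hρ1 hn)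

/-- ★★ **`KeyedExtraction` AT THE TOP-LETTERED READING IS A THEOREM** (the K3 skeleton's shape): `0 < l₀`, `0 < vol = (2L^m)⁴`, and E1 ∕ E2 for EVERY `g₀` (a fortiori
`ForSmallCouplings`) — rows `hsel`, (H-ζ). [bookkeeping] -/
theorem keyedExtraction_crTop₁₃VAt (K₀ : ℕ) (jcut : ℕ → ℕ) (ρ : WidthLetter₁₃CoPH N) (n : DepthLetter₁₃CoPH N) (θ : Stage13HParams F N) (hP : θ.Provisos₁₃CoPH F N)
    (E : B12.RunParams → ℝ) (hsel : θ.ppSel = ppSelLiveOfRecord F N θ.ν θ.τ9 E (wOfRecord₉ F N θ.toStage9Params)) (hζm : ZetaMeasurable F N θ.ζ) :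
    ForSmallCouplings (datumOfRecord₁₃CoPH F N θ hP) fun g₀ => ∀ os : List (ULoop F),
      0 < (crTop₁₃VAt N K₀ jcut ρ n F θ hP g₀ os).l₀ ∧ 0 < (crTop₁₃VAt N K₀ jcut ρ n F θ hP g₀ os).vol ∧
      (∀ (K : ℕ) (t : ℝ), |t| ≤ (crTop₁₃VAt N K₀ jcut ρ n F θ hP g₀ os).l₀ →
        T4GenFunBounds.schemeZ ((datumOfRecord₁₃CoPH F N θ hP).scheme g₀) os ((crTop₁₃VAt N K₀ jcut ρ n F θ hP g₀ os).K₀ + K) t =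
          ∑ τ ∈ (crTop₁₃VAt N K₀ jcut ρ n F θ hP g₀ os).T K, (crTop₁₃VAt N K₀ jcut ρ n F θ hP g₀ os).A K t τ) ∧
      (∀ (K : ℕ) (t : ℝ), |t| ≤ (crTop₁₃VAt N K₀ jcut ρ n F θ hP g₀ os).l₀ →
        T4GenFunBounds.schemeZ ((datumOfRecord₁₃CoPH F N θ hP).scheme g₀) os ((crTop₁₃VAt N K₀ jcut ρ n F θ hP g₀ os).K₀ + K + 1) t =
          ∑ τ ∈ (crTop₁₃VAt N K₀ jcut ρ n F θ hP g₀ os).T K, (crTop₁₃VAt N K₀ jcut ρ n F θ hP g₀ os).B K t τ) :=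
  ForSmallCouplings.of_forall fun g₀ os =>
    ⟨one_pos, pow_pos F.side_pos 4, fun K t _ => (sum_classSet₁₃_topWeightA₁₃_eq_schemeZ K₀ θ hP g₀ os E hsel hζm _ _ K t).symm,
      fun K t _ => (sum_classSet₁₃_topWeightB₁₃_eq_schemeZ K₀ θ hP g₀ os E hsel hζm _ _ K t).symm⟩

/-- ★ **N20 AT THE TOP-LETTERED READING FROM ANY WITNESS** (transfer; no estimate). [bookkeeping] -/
theorem relWeightBound_crTop₁₃VAt (K₀ : ℕ) (jcut : ℕ → ℕ) (ρ : WidthLetter₁₃CoPH N) (n : DepthLetter₁₃CoPH N) (θ : Stage13HParams F N) (hP : θ.Provisos₁₃CoPH F N)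
    (g₀ : ℕ → ℝ) (os : List (ULoop F)) {W : ℕ → ℝ}
    (h : RelWeightBound 1 (classSet₁₃ θ K₀ g₀) (topWeightA₁₃ θ hP K₀ g₀ os (ρ F θ hP g₀ os) (n F θ hP g₀ os)) (topWeightB₁₃ θ hP K₀ g₀ os (ρ F θ hP g₀ os) (n F θ hP g₀ os))
      (badClass₁₃ θ K₀ g₀ jcut) W) :
    RelWeightBound (crTop₁₃VAt N K₀ jcut ρ n F θ hP g₀ os).l₀ (crTop₁₃VAt N K₀ jcut ρ n F θ hP g₀ os).T (crTop₁₃VAt N K₀ jcut ρ n F θ hP g₀ os).A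
      (crTop₁₃VAt N K₀ jcut ρ n F θ hP g₀ os).B (crTop₁₃VAt N K₀ jcut ρ n F θ hP g₀ os).Bad (crTop₁₃VAt N K₀ jcut ρ n F θ hP g₀ os).W :=
  relWeightBound_wInf h

/-- ★ **N19′'s CORE AND U4′'s SUMMABILITY AT THE TOP-LETTERED READING's OWN RATE FROM ANY WITNESS** (transfer; no estimate). [bookkeeping] -/
theorem core_crTop₁₃VAt (K₀ : ℕ) (jcut : ℕ → ℕ) (ρ : WidthLetter₁₃CoPH N) (n : DepthLetter₁₃CoPH N) (θ : Stage13HParams F N) (hP : θ.Provisos₁₃CoPH F N)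
    (g₀ : ℕ → ℝ) (os : List (ULoop F)) {δ : ℕ → ℝ}
    (hP0 : letI : DecidableEq (Σ K, SiteSeqKey F (K₀ + K)) := Classical.decEq _
      ∀ (K : ℕ) (t : ℝ), |t| ≤ 1 → ∀ x ∈ classSet₁₃ θ K₀ g₀ K \ badClass₁₃ θ K₀ g₀ jcut K t,
        0 ≤ topWeightA₁₃ θ hP K₀ g₀ os (ρ F θ hP g₀ os) (n F θ hP g₀ os) K t x - topShellA₁₃ θ hP K₀ g₀ os (ρ F θ hP g₀ os) (n F θ hP g₀ os) K t x)
    (h : letI : DecidableEq (Σ K, SiteSeqKey F (K₀ + K)) := Classical.decEq _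
      NE7.Core 1 (F.side ^ 4) (classSet₁₃ θ K₀ g₀) (badClass₁₃ θ K₀ g₀ jcut)
        (fun K t x => topWeightA₁₃ θ hP K₀ g₀ os (ρ F θ hP g₀ os) (n F θ hP g₀ os) K t x - topShellA₁₃ θ hP K₀ g₀ os (ρ F θ hP g₀ os) (n F θ hP g₀ os) K t x)
        (fun K t x => topWeightB₁₃ θ hP K₀ g₀ os (ρ F θ hP g₀ os) (n F θ hP g₀ os) K t x - topShellB₁₃ θ hP K₀ g₀ os (ρ F θ hP g₀ os) (n F θ hP g₀ os) K t x) δ)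
    (hδ : Summable δ) :
    (letI := (crTop₁₃VAt N K₀ jcut ρ n F θ hP g₀ os).dec
     NE7.Core (crTop₁₃VAt N K₀ jcut ρ n F θ hP g₀ os).l₀ (crTop₁₃VAt N K₀ jcut ρ n F θ hP g₀ os).vol (crTop₁₃VAt N K₀ jcut ρ n F θ hP g₀ os).T
      (crTop₁₃VAt N K₀ jcut ρ n F θ hP g₀ os).Bad
      (fun K t τ => (crTop₁₃VAt N K₀ jcut ρ n F θ hP g₀ os).A K t τ - (crTop₁₃VAt N K₀ jcut ρ n F θ hP g₀ os).shA K t τ)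
      (fun K t τ => (crTop₁₃VAt N K₀ jcut ρ n F θ hP g₀ os).B K t τ - (crTop₁₃VAt N K₀ jcut ρ n F θ hP g₀ os).shB K t τ)
      (crTop₁₃VAt N K₀ jcut ρ n F θ hP g₀ os).δ) ∧ Summable (crTop₁₃VAt N K₀ jcut ρ n F θ hP g₀ os).δ := by
  letI : DecidableEq (Σ K, SiteSeqKey F (K₀ + K)) := Classical.decEq _
  letI := (crTop₁₃VAt N K₀ jcut ρ n F θ hP g₀ os).dec
  exact ⟨core_deltaCan (pow_pos F.side_pos 4).le hP0 h, summable_deltaCan (pow_pos F.side_pos 4).le hP0 h hδ⟩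

/-- **U4′'s `W + Wsh < 1` AT THE TOP-LETTERED READING FROM ANY WITNESSES** (transfer). [bookkeeping] -/
theorem lt_one_crTop₁₃VAt (K₀ : ℕ) (jcut : ℕ → ℕ) (ρ : WidthLetter₁₃CoPH N) (n : DepthLetter₁₃CoPH N) (θ : Stage13HParams F N) (hP : θ.Provisos₁₃CoPH F N)
    (g₀ : ℕ → ℝ) (os : List (ULoop F)) {W Wsh : ℕ → ℝ}
    (hW : RelWeightBound 1 (classSet₁₃ θ K₀ g₀) (topWeightA₁₃ θ hP K₀ g₀ os (ρ F θ hP g₀ os) (n F θ hP g₀ os))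
      (topWeightB₁₃ θ hP K₀ g₀ os (ρ F θ hP g₀ os) (n F θ hP g₀ os)) (badClass₁₃ θ K₀ g₀ jcut) W)
    (hSh : ShellWeightBound 1 (classSet₁₃ θ K₀ g₀) (topWeightA₁₃ θ hP K₀ g₀ os (ρ F θ hP g₀ os) (n F θ hP g₀ os))
      (topWeightB₁₃ θ hP K₀ g₀ os (ρ F θ hP g₀ os) (n F θ hP g₀ os)) (topShellA₁₃ θ hP K₀ g₀ os (ρ F θ hP g₀ os) (n F θ hP g₀ os))
      (topShellB₁₃ θ hP K₀ g₀ os (ρ F θ hP g₀ os) (n F θ hP g₀ os)) Wsh)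
    (hlt : ∀ K, W K + Wsh K < 1) (K : ℕ) :
    (crTop₁₃VAt N K₀ jcut ρ n F θ hP g₀ os).W K + (crTop₁₃VAt N K₀ jcut ρ n F θ hP g₀ os).Wsh K < 1 :=
  wInf_add_wshInf_lt_one hW hSh hlt K

/-- **THE SELECTED TOP LETTER OF RUN A LIES IN THE WINDOW `[ε(1 − ρ_K)^n, ε]`** below print's `ε = ε_{K₀+K}` (for `0 ≤ ρ_K ≤ 1`, `0 ≤ ε`): the consumer's
admissible-factor obligation ([LF-I] p.181) reads `(1 − ρ_K)^{n_K} ≥` its factor — e.g. `n_K ρ_K ≤ β` gives `≥ 1 − β` — jointly with `Σ_K 1∕(n_K+1) < ∞`; both hold for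
`ρ_K = cϑ^K` (N16's geometric closeness) and `n_K ≍ β∕ρ_K`. [bookkeeping] -/
theorem selTopCutA_mem_window (K₀ : ℕ) (θ : Stage13HParams F N) (hP : θ.Provisos₁₃CoPH F N) (g₀ : ℕ → ℝ) (os : List (ULoop F)) {ρ : ℕ → ℝ}
    (hρ0 : ∀ K, 0 ≤ ρ K) (hρ1 : ∀ K, ρ K ≤ 1) (n K : ℕ) (t : ℝ) (hε : 0 ≤ epsOfRecord θ.ν (histA₁₃ θ K₀ g₀ K) (K₀ + K)) :
    epsOfRecord θ.ν (histA₁₃ θ K₀ g₀ K) (K₀ + K) * (1 - ρ K) ^ n ≤ cutGrid θ.ν (histA₁₃ θ K₀ g₀ K) (K₀ + K) (ρ K) (selTopDepth₁₃ θ hP K₀ g₀ os ρ n K t) ∧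
      cutGrid θ.ν (histA₁₃ θ K₀ g₀ K) (K₀ + K) (ρ K) (selTopDepth₁₃ θ hP K₀ g₀ os ρ n K t) ≤ epsOfRecord θ.ν (histA₁₃ θ K₀ g₀ K) (K₀ + K) := by
  unfold cutGrid
  exact ⟨mul_le_mul_of_nonneg_left (pow_le_pow_of_le_one (by linarith [hρ0 K, hρ1 K]) (by linarith [hρ0 K, hρ1 K]) (selTopDepth₁₃_le θ hP K₀ g₀ os ρ n K t)) hε,
    mul_le_of_le_one_right hε (pow_le_one₀ (by linarith [hρ0 K, hρ1 K]) (by linarith [hρ0 K, hρ1 K]))⟩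

/-- **THE SELECTED TOP LETTER OF RUN B LIES IN THE WINDOW `[ε′(1 − ρ_K)^n, ε′]`** below print's `ε′ = ε_{K₀+K+1}` (same depth `i⋆(K,t)`, same relative factor). [bookkeeping] -/
theorem selTopCutB_mem_window (K₀ : ℕ) (θ : Stage13HParams F N) (hP : θ.Provisos₁₃CoPH F N) (g₀ : ℕ → ℝ) (os : List (ULoop F)) {ρ : ℕ → ℝ}
    (hρ0 : ∀ K, 0 ≤ ρ K) (hρ1 : ∀ K, ρ K ≤ 1) (n K : ℕ) (t : ℝ) (hε : 0 ≤ epsOfRecord θ.ν (histB₁₃ θ K₀ g₀ K) (K₀ + K + 1)) :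
    epsOfRecord θ.ν (histB₁₃ θ K₀ g₀ K) (K₀ + K + 1) * (1 - ρ K) ^ n ≤
        cutGrid θ.ν (histB₁₃ θ K₀ g₀ K) (K₀ + K + 1) (ρ K) (selTopDepth₁₃ θ hP K₀ g₀ os ρ n K t) ∧
      cutGrid θ.ν (histB₁₃ θ K₀ g₀ K) (K₀ + K + 1) (ρ K) (selTopDepth₁₃ θ hP K₀ g₀ os ρ n K t) ≤ epsOfRecord θ.ν (histB₁₃ θ K₀ g₀ K) (K₀ + K + 1) := by
  unfold cutGrid
  exact ⟨mul_le_mul_of_nonneg_left (pow_le_pow_of_le_one (by linarith [hρ0 K, hρ1 K]) (by linarith [hρ0 K, hρ1 K]) (selTopDepth₁₃_le θ hP K₀ g₀ os ρ n K t)) hε,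
    mul_le_of_le_one_right hε (pow_le_one₀ (by linarith [hρ0 K, hρ1 K]) (by linarith [hρ0 K, hρ1 K]))⟩

end AtReading

end Summit.QuantumFields.YangMills.Theorems.N21ShellSplitOfRecord13CoPH

end
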